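import Summits.FinalStateConjecture.FinalStateConjecture.Theorems.PhaseMixingCaptureCaptureSufficesTameNoC0KerrSide
import Summits.FinalStateConjecture.FinalStateConjecture.Theorems.PhaseMixingCaptureCaptureSufficesTameNoC0GenCone
import Summits.FinalStateConjecture.FinalStateConjecture.Theorems.EIHFluxBalanceModulatedKerrHandoffDragDefectMinkowski
import Literature.Geometry.Lorentzian.CoordTensorCovariance
import HarnessLib

/-!
# `CaptureSufficesTame` (stmt-FinalStateConjecture-17270), line `only-the-third-law-is-generic`: glue stub
# `stub_noC0_glue` (oriented form), helper file 1 — the chart toolkit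

The model-point limit argument NoC0KerrChart of the line reads, at every level, a smooth injective chart `Φ` of a
control region `Ω` of the Kerr exterior (Kerr–Schild coordinates on `E4`) into Minkowski space with
`‖Φ^*η − g_{M,a}‖ ≤ ε` on `Ω`, where `Φ^*η = MetricCoord.pullMetric (fun _ ↦ Minkowski.bilin) Φ`. This file is the
analytic toolkit of such `ε`-isometries (namespace `NoC0Glue`):

* quantitative nondegeneracy of the Kerr–Schild metric on the exterior (`0 ≤ H ≤ 1`, `‖ℓ♯‖² = 2`): a bilinear
  form `B` with `‖B − g_{M,a}(x)‖ ≤ ε < 1/5` has trivial kernel (`eq_zero_of_forall_apply_eq_zero`);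
* hence `DΦ_y` is invertible for `y ∈ Ω` (`exists_equiv_fderiv`), `Φ` maps open subsets of `Ω` to open sets
  (`isOpen_image`, inverse function theorem), and a left inverse `G` of `Φ` on `Ω` is continuous and differentiable
  at the points of `Φ '' Ω` with `DG = (DΦ)⁻¹` (`continuousAt_inverse`, `hasFDerivAt_inverse`);
* transport of vectors and curves: `(Φ^*η)((DΦ)⁻¹w, (DΦ)⁻¹w) = η(w, w)`, chain rules in both directions, and the
  time orientation of pulled-back causal vectors under the ORIENTATION HYPOTHESIS that `DΦ` maps future
  `Φ^*η`-causal vectors to vectors with positive time component (`time_pos_of_fderiv_time_pos`,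
  `symm_causal_future`) — without it a chart may reverse time orientation (time reflection of Minkowski space);
* `stub_noC0_glueChart` — the toolkit assembled (registered helper sub-goal of the glue stub).

References: B. O'Neill, *Semi-Riemannian geometry*, Academic Press 1983, Ch. 3 (pull-backs, isometries) and Ch. 5
(causal character); R. P. Kerr, A. Schild 1965, §2; M. Visser, arXiv:0706.0622, (32)–(35); the inverse function
theorem (Mathlib `HasStrictFDerivAt.map_nhds_eq_of_equiv`, `HasFDerivAt.of_local_left_inverse`).
-/

-- the doubled `FinalStateConjecture.FinalStateConjecture` path component trips dupNamespace (as in the skeleton)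
set_option linter.dupNamespace false
set_option maxSynthPendingDepth 3

noncomputable section

open Set Filter Function Metric
open scoped Topology ContDiff

namespace Summit.FinalStateConjecture.FinalStateConjecture.Theorems.PhaseMixingCaptureCaptureSufficesTame

open Literature.Geometry.Lorentzian

namespace NoC0Glue

/-! ## Euclidean bounds for the Kerr–Schild data -/

/-- `‖ℓ♯‖² = 2` wherever `r > 0`: `η(ℓ♯, ℓ♯) = ℓ(ℓ♯) = 0` and `(ℓ♯)⁰ = −1` (Visser arXiv:0706.0622, (34)–(35)).
[cite: arXiv07060622, (34)–(35)] -/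
theorem norm_nullVector_sq {a : ℝ} {x : E4} (hx : 0 < Kerr.radius a x) : ‖Kerr.nullVector a x‖ ^ 2 = 2 := by
  have h0 : Kerr.nullVector a x 0 = -1 := by simp [Kerr.nullVector, Kerr.nullCovectorFun]
  rw [gen_norm_sq, Kerr.bilin_nullVector, Kerr.nullCovector_nullVector hx, h0]
  norm_num

/-- On the Kerr–Schild chart domain the scalar `H = M r³/(r⁴ + a² z²)` satisfies `H ≤ 1` on the exterior
`{r > max(r₊, 0)}`: `M r³ ≤ r⁴` since `r ≥ r₊ ≥ M` (Visser arXiv:0706.0622, (33)). [cite: arXiv07060622, (33)] -/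
theorem scalarH_le_one {M a : ℝ} {x : E4} (hx : x ∈ (Kerr.exterior M a : Set E4)) :
    Kerr.scalarH M a x ≤ 1 := by
  have hx' : x ∈ Kerr.exterior M a := hx
  rw [Kerr.exterior, Kerr.mem_region] at hx'
  have hr0 : 0 < Kerr.radius a x := (le_max_right _ _).trans_lt hx'
  have hrp : Kerr.rPlus M a < Kerr.radius a x := (le_max_left _ _).trans_lt hx'
  have hMr : M ≤ Kerr.radius a x := by
    have : M ≤ Kerr.rPlus M a := by
      unfold Kerr.rPlus
      linarith [Real.sqrt_nonneg (M ^ 2 - a ^ 2)]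
    linarith
  unfold Kerr.scalarH
  set r := Kerr.radius a x
  have hD : 0 < r ^ 4 + a ^ 2 * x 3 ^ 2 := by positivity
  rw [div_le_one hD]
  have h3 : 0 ≤ r ^ 3 := by positivity
  nlinarith [mul_le_mul_of_nonneg_right hMr h3, sq_nonneg (a * x 3)]

/-! ## The derivative of an `ε`-isometry into Minkowski space is invertible -/

/-- **Quantitative nondegeneracy of the Kerr–Schild metric.** On the exterior (`0 ≤ M`), if a bilinear form
`B` with `‖B − g_{M,a}(x)‖ ≤ ε`, `ε < 1/5`, annihilates `v` (`B(v, ·) = 0`), then `v = 0`: with `v'` the time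
reflection of `v` and `w = v' − 2H ℓ(v') ℓ♯` one has `g(v, w) = ‖v‖²` and `‖w‖ ≤ 5‖v‖` (`0 ≤ H ≤ 1`,
`‖ℓ♯‖² = 2`), while `|g(v, w)| = |(B − g)(v, w)| ≤ ε ‖v‖ ‖w‖`. Kerr–Schild 1965, §2 (`g = η + 2Hℓ⊗ℓ` is
nondegenerate); Visser arXiv:0706.0622, (32)–(35). [cite: arXiv07060622, (32)–(35)] -/
theorem eq_zero_of_forall_apply_eq_zero {M a : ℝ} (hM : 0 ≤ M) {x : E4} (hx : x ∈ (Kerr.exterior M a : Set E4))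
    {B : E4 →L[ℝ] E4 →L[ℝ] ℝ} {ε : ℝ} (hB : ‖B - Kerr.bilin M a x‖ ≤ ε) (hε : ε < 1 / 5) {v : E4}
    (hv : ∀ w, B v w = 0) : v = 0 := by
  have hr : 0 < Kerr.radius a x := Kerr.radius_pos_of_mem_region hx
  have hsmall : ∀ w, |Kerr.bilin M a x v w| ≤ ε * ‖v‖ * ‖w‖ := by
    intro w
    have h1 := (B - Kerr.bilin M a x).le_opNorm₂ v w
    rw [sub_apply, sub_apply, hv, zero_sub, norm_neg, Real.norm_eq_abs] at h1
    refine h1.trans ?_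
    gcongr
  have hH0 : 0 ≤ Kerr.scalarH M a x := Kerr.scalarH_nonneg hM a x
  have hH1 : Kerr.scalarH M a x ≤ 1 := scalarH_le_one hx
  obtain ⟨H, hH⟩ : ∃ H, H = Kerr.scalarH M a x := ⟨_, rfl⟩
  obtain ⟨L, hL⟩ : ∃ L, L = Kerr.nullCovector a x := ⟨_, rfl⟩
  obtain ⟨N, hN⟩ : ∃ N, N = Kerr.nullVector a x := ⟨_, rfl⟩
  rw [← hH] at hH0 hH1
  obtain ⟨v', hv'⟩ : ∃ v' : E4, v' = v - (2 * v 0) • E4.basisVector 0 := ⟨_, rfl⟩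
  obtain ⟨w, hw⟩ : ∃ w : E4, w = v' - (2 * H * L v') • N := ⟨_, rfl⟩
  -- `η(v, v') = ‖v‖²` and `‖v'‖ = ‖v‖`
  have hvv' : Minkowski.bilin v v' = ‖v‖ ^ 2 := by
    rw [hv', map_sub, map_smul, Minkowski.bilin_symm v (E4.basisVector 0), Minkowski.bilin_basisVector_zero_left,
      gen_norm_sq, smul_eq_mul]
    ring
  have hnv' : ‖v'‖ = ‖v‖ := by
    have h : ‖v'‖ ^ 2 = ‖v‖ ^ 2 := by
      rw [gen_norm_sq, gen_norm_sq v]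
      have h0 : v' 0 = -v 0 := by
        rw [hv']
        simp
        ring
      rw [h0, hv']
      simp only [map_sub, map_smul, sub_apply, smul_apply, smul_eq_mul, Minkowski.bilin_basisVector_zero_left,
        Minkowski.bilin_symm v (E4.basisVector 0)]
      simp
      ring
    exact (sq_eq_sq₀ (norm_nonneg _) (norm_nonneg _)).1 h
  -- `g(v, w) = ‖v‖²`
  have hLN : L N = 0 := by
    rw [hL, hN]
    exact Kerr.nullCovector_nullVector hr
  have hvN : Minkowski.bilin v N = L v := by
    rw [hL, hN]
    exact Kerr.bilin_nullVector_right a x v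
  have hηw : Minkowski.bilin v w = ‖v‖ ^ 2 - (2 * H * L v') * L v := by
    rw [hw, map_sub, map_smul, hvv', hvN, smul_eq_mul]
  have hLw : L w = L v' := by
    rw [hw, map_sub, map_smul, hLN, smul_eq_mul, mul_zero, sub_zero]
  have hgw : Kerr.bilin M a x v w = ‖v‖ ^ 2 := by
    rw [Kerr.bilin_apply, hηw, ← hL, ← hH, hLw]
    ring
  -- `‖w‖ ≤ 5 ‖v‖`
  have hwn : ‖w‖ ≤ 5 * ‖v‖ := by
    have hLv : |L v'| ≤ ‖N‖ * ‖v‖ := by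
      rw [hL, hN, ← Kerr.bilin_nullVector, ← hnv']
      exact DragDefect.abs_minkowski_le _ _
    have hNsq : ‖N‖ ^ 2 = 2 := by
      rw [hN]
      exact norm_nullVector_sq hr
    have h1 : ‖(2 * H * L v') • N‖ ≤ 4 * ‖v‖ := by
      rw [norm_smul, Real.norm_eq_abs, abs_mul, abs_mul, abs_of_nonneg hH0, abs_two]
      calc 2 * H * |L v'| * ‖N‖ ≤ 2 * H * (‖N‖ * ‖v‖) * ‖N‖ := by gcongr
        _ = 4 * H * ‖v‖ := by
            rw [show 2 * H * (‖N‖ * ‖v‖) * ‖N‖ = 2 * H * ‖v‖ * ‖N‖ ^ 2 by ring, hNsq]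
            ring
        _ ≤ 4 * ‖v‖ := by nlinarith [norm_nonneg v]
    calc ‖w‖ ≤ ‖v'‖ + ‖(2 * H * L v') • N‖ := by rw [hw]; exact norm_sub_le _ _
      _ ≤ ‖v‖ + 4 * ‖v‖ := by rw [hnv']; gcongr
      _ = 5 * ‖v‖ := by ring
  -- conclusion
  have key := hsmall w
  rw [hgw, abs_of_nonneg (by positivity)] at key
  have hε0 : 0 ≤ ε := le_trans (norm_nonneg _) hB
  have h5 : ‖v‖ ^ 2 ≤ 5 * ε * ‖v‖ ^ 2 := by
    calc ‖v‖ ^ 2 ≤ ε * ‖v‖ * ‖w‖ := key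
      _ ≤ ε * ‖v‖ * (5 * ‖v‖) := by gcongr
      _ = 5 * ε * ‖v‖ ^ 2 := by ring
  have hv0 : ‖v‖ ^ 2 = 0 := by nlinarith [sq_nonneg ‖v‖]
  exact norm_eq_zero.1 (pow_eq_zero_iff two_ne_zero |>.1 hv0)

/-! ## The chart `Φ`: invertible derivative, open images, continuous and differentiable inverse -/

section Chart

variable {M a ε : ℝ} {Ω : Set E4} {Φ G : E4 → E4}

/-- **The derivative of an `ε`-isometry of a Kerr chunk into Minkowski space is invertible** (`ε < 1/5`): if
`DΦ_y v = 0` then `(Φ^*η)_y(v, ·) = 0`, so `v = 0` by the quantitative nondegeneracy of `g_{M,a}(y)`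
(`eq_zero_of_forall_apply_eq_zero`); an injective endomorphism of `ℝ⁴` is invertible. [folklore] -/
theorem exists_equiv_fderiv (hM : 0 ≤ M) (hΩext : Ω ⊆ (Kerr.exterior M a : Set E4)) (hε : ε < 1 / 5)
    (hclose : ∀ y ∈ Ω, ‖MetricCoord.pullMetric (fun _ ↦ Minkowski.bilin) Φ y - Kerr.bilin M a y‖ ≤ ε)
    {y : E4} (hy : y ∈ Ω) : ∃ e : E4 ≃L[ℝ] E4, (e : E4 →L[ℝ] E4) = fderiv ℝ Φ y := by
  have hinj : Injective (fderiv ℝ Φ y) := by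
    intro v₁ v₂ h
    rw [← sub_eq_zero]
    refine eq_zero_of_forall_apply_eq_zero hM (hΩext hy) (hclose y hy) hε fun w ↦ ?_
    show Minkowski.bilin (fderiv ℝ Φ y (v₁ - v₂)) (fderiv ℝ Φ y w) = 0
    rw [map_sub, h, sub_self, map_zero, zero_apply]
  have hbij : Bijective (fderiv ℝ Φ y).toLinearMap := ⟨hinj, LinearMap.surjective_of_injective hinj⟩
  exact ⟨(LinearEquiv.ofBijective _ hbij).toContinuousLinearEquiv, by ext v; rfl⟩

/-- `Φ` is strictly differentiable at the points of the open set `Ω` on which it is `C^∞`. [folklore] -/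
theorem hasStrictFDerivAt_chart (hΩ : IsOpen Ω) (hΦ : ContDiffOn ℝ ∞ Φ Ω) {y : E4} (hy : y ∈ Ω) :
    HasStrictFDerivAt Φ (fderiv ℝ Φ y) y :=
  (hΦ.contDiffAt (hΩ.mem_nhds hy)).hasStrictFDerivAt (by simp)

/-- `Φ` is continuous at the points of `Ω`. [folklore] -/
theorem continuousAt_chart (hΩ : IsOpen Ω) (hΦ : ContDiffOn ℝ ∞ Φ Ω) {y : E4} (hy : y ∈ Ω) : ContinuousAt Φ y :=
  (hΦ.contDiffAt (hΩ.mem_nhds hy)).continuousAt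

/-- **Open mapping**: an `ε`-isometry `Φ` (`ε < 1/5`) maps open subsets of `Ω` to open sets (inverse function
theorem, `HasStrictFDerivAt.map_nhds_eq_of_equiv`). [folklore] -/
theorem isOpen_image (hM : 0 ≤ M) (hΩ : IsOpen Ω) (hΩext : Ω ⊆ (Kerr.exterior M a : Set E4))
    (hΦ : ContDiffOn ℝ ∞ Φ Ω) (hε : ε < 1 / 5)
    (hclose : ∀ y ∈ Ω, ‖MetricCoord.pullMetric (fun _ ↦ Minkowski.bilin) Φ y - Kerr.bilin M a y‖ ≤ ε)
    {V : Set E4} (hV : IsOpen V) (hVΩ : V ⊆ Ω) : IsOpen (Φ '' V) := by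
  rw [isOpen_iff_mem_nhds]
  rintro _ ⟨y, hyV, rfl⟩
  obtain ⟨e, he⟩ := exists_equiv_fderiv hM hΩext hε hclose (hVΩ hyV)
  have hsd : HasStrictFDerivAt Φ (e : E4 →L[ℝ] E4) y := he ▸ hasStrictFDerivAt_chart hΩ hΦ (hVΩ hyV)
  rw [← hsd.map_nhds_eq_of_equiv]
  exact image_mem_map (hV.mem_nhds hyV)

/-- **The inverse chart is continuous**: a left inverse `G` of `Φ` on `Ω` (`G (Φ y) = y`) is continuous at
every point of `Φ '' Ω` (the images of small open neighbourhoods are open neighbourhoods). [folklore] -/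
theorem continuousAt_inverse (hM : 0 ≤ M) (hΩ : IsOpen Ω) (hΩext : Ω ⊆ (Kerr.exterior M a : Set E4))
    (hΦ : ContDiffOn ℝ ∞ Φ Ω) (hε : ε < 1 / 5)
    (hclose : ∀ y ∈ Ω, ‖MetricCoord.pullMetric (fun _ ↦ Minkowski.bilin) Φ y - Kerr.bilin M a y‖ ≤ ε)
    (hG : ∀ y ∈ Ω, G (Φ y) = y) {y : E4} (hy : y ∈ Ω) : ContinuousAt G (Φ y) := by
  rw [ContinuousAt, hG y hy, tendsto_def]
  intro V' hV'
  obtain ⟨V, hVV', hVo, hyV⟩ := _root_.mem_nhds_iff.1 hV'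
  have ho := isOpen_image hM hΩ hΩext hΦ hε hclose (hVo.inter hΩ) inter_subset_right
  refine mem_of_superset (ho.mem_nhds ⟨y, ⟨hyV, hy⟩, rfl⟩) ?_
  rintro _ ⟨y', ⟨hy'V, hy'Ω⟩, rfl⟩
  show G (Φ y') ∈ V'
  rw [hG y' hy'Ω]
  exact hVV' hy'V

/-- **The inverse chart is differentiable** with `DG_{Φ y} = (DΦ_y)⁻¹` (`HasFDerivAt.of_local_left_inverse`).
[folklore] -/
theorem hasFDerivAt_inverse (hM : 0 ≤ M) (hΩ : IsOpen Ω) (hΩext : Ω ⊆ (Kerr.exterior M a : Set E4))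
    (hΦ : ContDiffOn ℝ ∞ Φ Ω) (hε : ε < 1 / 5)
    (hclose : ∀ y ∈ Ω, ‖MetricCoord.pullMetric (fun _ ↦ Minkowski.bilin) Φ y - Kerr.bilin M a y‖ ≤ ε)
    (hG : ∀ y ∈ Ω, G (Φ y) = y) {y : E4} (hy : y ∈ Ω) {e : E4 ≃L[ℝ] E4}
    (he : (e : E4 →L[ℝ] E4) = fderiv ℝ Φ y) : HasFDerivAt G (e.symm : E4 →L[ℝ] E4) (Φ y) := by
  refine HasFDerivAt.of_local_left_inverse (f := Φ) (continuousAt_inverse hM hΩ hΩext hΦ hε hclose hG hy) ?_ ?_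
  · rw [hG y hy, he]
    exact (hasStrictFDerivAt_chart hΩ hΦ hy).hasFDerivAt
  · filter_upwards [(isOpen_image hM hΩ hΩext hΦ hε hclose hΩ Subset.rfl).mem_nhds ⟨y, hy, rfl⟩]
    rintro _ ⟨y', hy', rfl⟩
    rw [hG y' hy']

/-! ## Transport of vectors and curves through the chart -/

/-- `(Φ^*η)_y((DΦ_y)⁻¹ w₁, (DΦ_y)⁻¹ w₂) = η(w₁, w₂)` (definition of the pull-back). [folklore] -/
theorem pullMetric_symm_apply {y : E4} {e : E4 ≃L[ℝ] E4} (he : (e : E4 →L[ℝ] E4) = fderiv ℝ Φ y)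
    (w₁ w₂ : E4) :
    MetricCoord.pullMetric (fun _ ↦ Minkowski.bilin) Φ y (e.symm w₁) (e.symm w₂) = Minkowski.bilin w₁ w₂ := by
  simp only [MetricCoord.pullMetric_apply]
  rw [← he]
  simp

/-- **Time orientation of pulled-back vectors.** If `DΦ_y` maps the future `(Φ^*η)_y`-causal cone into the
future half space (hypothesis `hO`) and `‖(Φ^*η)_y − g_{M,a}(y)‖ ≤ 1/4`, then conversely a
`(Φ^*η)_y`-causal `v` with `(DΦ_y v)⁰ > 0` has `v⁰ > 0`: `v⁰ < 0` would send `−v` to the future, and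
`v⁰ = 0` forces `v = 0` (`‖v‖ ≤ 2|v⁰|`, brick K). [folklore] -/
theorem time_pos_of_fderiv_time_pos (hM : 0 ≤ M) {y : E4}
    (hB : ‖MetricCoord.pullMetric (fun _ ↦ Minkowski.bilin) Φ y - Kerr.bilin M a y‖ ≤ 1 / 4)
    (hO : ∀ v : E4, MetricCoord.pullMetric (fun _ ↦ Minkowski.bilin) Φ y v v ≤ 0 → 0 < v 0 →
      0 < (fderiv ℝ Φ y v) 0)
    {v : E4} (hv : MetricCoord.pullMetric (fun _ ↦ Minkowski.bilin) Φ y v v ≤ 0) (hpos : 0 < (fderiv ℝ Φ y v) 0) :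
    0 < v 0 := by
  rcases lt_trichotomy (v 0) 0 with hneg | hzero | hpos'
  · have h1 := hO (-v) (by simpa using hv) (by simp only [PiLp.neg_apply]; linarith)
    simp only [map_neg, PiLp.neg_apply] at h1
    linarith
  · exfalso
    have hn := kerr_norm_le_two_mul_abs_time M a y v _ hM hB hv
    rw [hzero, abs_zero, mul_zero] at hn
    have h0 : v = 0 := norm_le_zero_iff.1 hn
    rw [h0, map_zero] at hpos
    simp at hpos
  · exact hpos'

/-- **Pull-back of a future causal vector of Minkowski space**: for `w` with `η(w, w) ≤ 0 < w⁰`, the vector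
`v = (DΦ_y)⁻¹ w` is `(Φ^*η)_y`-causal, `(Φ^*η)_y(v, v) = η(w, w)`, and future, `v⁰ > 0`. [folklore] -/
theorem symm_causal_future (hM : 0 ≤ M) {y : E4}
    (hB : ‖MetricCoord.pullMetric (fun _ ↦ Minkowski.bilin) Φ y - Kerr.bilin M a y‖ ≤ 1 / 4)
    (hO : ∀ v : E4, MetricCoord.pullMetric (fun _ ↦ Minkowski.bilin) Φ y v v ≤ 0 → 0 < v 0 →
      0 < (fderiv ℝ Φ y v) 0)
    {e : E4 ≃L[ℝ] E4} (he : (e : E4 →L[ℝ] E4) = fderiv ℝ Φ y) {w : E4} (hw : Minkowski.bilin w w ≤ 0)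
    (hw0 : 0 < w 0) :
    MetricCoord.pullMetric (fun _ ↦ Minkowski.bilin) Φ y (e.symm w) (e.symm w) = Minkowski.bilin w w ∧
      0 < e.symm w 0 := by
  refine ⟨pullMetric_symm_apply he w w, time_pos_of_fderiv_time_pos hM hB hO ?_ ?_⟩
  · rw [pullMetric_symm_apply he]
    exact hw
  · rw [← he]
    simpa using hw0

/-- **Source to target**: a curve `c` with `c t ∈ Ω` and `c'(t) = v` maps to `Φ ∘ c` with
`(Φ ∘ c)'(t) = DΦ_{c t} v` (chain rule), and `η(DΦ v, DΦ v) = (Φ^*η)_{c t}(v, v)`. [folklore] -/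
theorem hasDerivAt_comp (hΩ : IsOpen Ω) (hΦ : ContDiffOn ℝ ∞ Φ Ω) {c : ℝ → E4} {v : E4} {t : ℝ}
    (hc : HasDerivAt c v t) (ht : c t ∈ Ω) :
    HasDerivAt (Φ ∘ c) (fderiv ℝ Φ (c t) v) t ∧
      Minkowski.bilin (fderiv ℝ Φ (c t) v) (fderiv ℝ Φ (c t) v) =
        MetricCoord.pullMetric (fun _ ↦ Minkowski.bilin) Φ (c t) v v := by
  refine ⟨?_, by simp⟩
  have hd : DifferentiableAt ℝ Φ (c t) :=
    ((hΦ.contDiffAt (hΩ.mem_nhds ht)).differentiableAt (by simp))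
  exact hd.hasFDerivAt.comp_hasDerivAt t hc

/-- **Target to source**: a curve `γ` of Minkowski space with `γ t = Φ y`, `y ∈ Ω`, and `γ'(t) = w` pulls
back to `G ∘ γ` with `(G ∘ γ)'(t) = (DΦ_y)⁻¹ w` (chain rule with `hasFDerivAt_inverse`). [folklore] -/
theorem hasDerivAt_inverse_comp (hM : 0 ≤ M) (hΩ : IsOpen Ω) (hΩext : Ω ⊆ (Kerr.exterior M a : Set E4))
    (hΦ : ContDiffOn ℝ ∞ Φ Ω) (hε : ε < 1 / 5)
    (hclose : ∀ y ∈ Ω, ‖MetricCoord.pullMetric (fun _ ↦ Minkowski.bilin) Φ y - Kerr.bilin M a y‖ ≤ ε)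
    (hG : ∀ y ∈ Ω, G (Φ y) = y) {y : E4} (hy : y ∈ Ω) {e : E4 ≃L[ℝ] E4}
    (he : (e : E4 →L[ℝ] E4) = fderiv ℝ Φ y) {γ : ℝ → E4} {w : E4} {t : ℝ} (hγ : HasDerivAt γ w t)
    (hγt : γ t = Φ y) : HasDerivAt (G ∘ γ) (e.symm w) t := by
  have hG' := hasFDerivAt_inverse hM hΩ hΩext hΦ hε hclose hG hy he
  rw [← hγt] at hG'
  exact hG'.comp_hasDerivAt t hγ

end Chart

end NoC0Glue

open NoC0Glue in
/-- **Chart toolkit (registered helper sub-goal `stub_noC0_glueChart` of the glue stub).** For a `C^∞` map `Φ` on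
an open `Ω ⊆` Kerr exterior (`0 ≤ M`) with `‖Φ^*η − g_{M,a}‖ ≤ ε < 1/5` on `Ω`: every `DΦ_y`, `y ∈ Ω`, is
invertible; `Φ` maps open subsets of `Ω` to open sets; and every left inverse `G` of `Φ` on `Ω` is continuous at
`Φ y` and differentiable there with `DG_{Φ y} = (DΦ_y)⁻¹` (inverse function theorem for an `ε`-isometry of the
uniformly nondegenerate Kerr–Schild metric). [folklore] -/
theorem stub_noC0_glueChart :
    ∀ (M a : ℝ) (Ω : Set E4) (Φ : E4 → E4) (ε : ℝ), 0 ≤ M → IsOpen Ω → Ω ⊆ (Kerr.exterior M a : Set E4) →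
      ContDiffOn ℝ ∞ Φ Ω → ε < 1 / 5 →
      (∀ y ∈ Ω, ‖MetricCoord.pullMetric (fun _ ↦ Minkowski.bilin) Φ y - Kerr.bilin M a y‖ ≤ ε) →
      (∀ y ∈ Ω, (fderiv ℝ Φ y).IsInvertible) ∧ (∀ V ⊆ Ω, IsOpen V → IsOpen (Φ '' V)) ∧
      ∀ G : E4 → E4, (∀ y ∈ Ω, G (Φ y) = y) → ∀ y ∈ Ω, ContinuousAt G (Φ y) ∧
        ∃ e : E4 ≃L[ℝ] E4, (e : E4 →L[ℝ] E4) = fderiv ℝ Φ y ∧ HasFDerivAt G (e.symm : E4 →L[ℝ] E4) (Φ y) := by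
  intro M a Ω Φ ε hM hΩ hΩext hΦ hε hclose
  refine ⟨fun y hy ↦ ?_, fun V hVΩ hV ↦ isOpen_image hM hΩ hΩext hΦ hε hclose hV hVΩ,
    fun G hG y hy ↦ ⟨continuousAt_inverse hM hΩ hΩext hΦ hε hclose hG hy, ?_⟩⟩
  · obtain ⟨e, he⟩ := exists_equiv_fderiv hM hΩext hε hclose hy
    exact ⟨e, he⟩
  · obtain ⟨e, he⟩ := exists_equiv_fderiv hM hΩext hε hclose hy
    exact ⟨e, he, hasFDerivAt_inverse hM hΩ hΩext hΦ hε hclose hG hy he⟩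

end Summit.FinalStateConjecture.FinalStateConjecture.Theorems.PhaseMixingCaptureCaptureSufficesTame

end
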